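/-
Copyright (c) 2026. All rights reserved.
Released under Apache 2.0 license as described in the file LICENSE.
Authors: HodgeCM publication cell (pub-hodgecm), GR lane, seat GR-2 (`pub-hodgecm-own-hyp34`).
-/
import Literature.NumberTheory.Weil1964.ArchMetaplecticLeviSection
import Literature.NumberTheory.Weil1964.ArchPlacePhaseHom
import HarnessLib

/-!
# Block-diagonal symplectic elements over a finite set of places and the place-by-place conjugated Levi section

Topic `NumberTheory/Weil1964`; namespace `Literature.NumberTheory.Weil1964` (continues `ArchMetaplecticLeviSection`,
`ArchVacuumSectionPlaces`).  KERNEL ONLY: definitions with bodies and theorems; no `def … : Prop` record, no `axiom`,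
no proof hole.

For a finite set of places `o` and an index `m`, the phase space `ℝ^{m × o} × ℝ^{m × o}` is the orthogonal sum over
`v ∈ o` of the slices `ℝ^m × ℝ^m` (`ArchVacuumSectionPlaces.placePhase`).  This file packages the slice-by-slice
constructions as GROUP HOMOMORPHISMS into the symplectic and general linear groups and reads the conjugated Levi
section `MpS.leviAlong` of `ArchMetaplecticLeviSection` through them:

* §1 the tree's **`placeSp : (o → Sp(ℝ^m × ℝ^m)) →* Sp(ℝ^{m×o} × ℝ^{m×o})`** (`ArchPlacePhaseHom`, acting by
  `placePhase`) is the symplectic side; here **`GL.placeDiag : (o → GL_m(ℝ)) →* GL_{m × o}(ℝ)`** (`Matrix.blockDiagonal`), `glEquiv (GL.placeDiag a) = placeLin`,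
  `trInv` is slicewise, and the Siegel Levi of a block-diagonal matrix is the block-diagonal of the Siegel Levis:
  `proj (leviGL (GL.placeDiag a)) = placeSp (v ↦ proj (leviGL (a v)))` (`proj_leviGL_placeDiag`);
* §2 for a homomorphism `A : G →* (o → GL_m(ℝ))`, a family `κ : o → Sp(ℝ^m × ℝ^m)` and a lift `x ∈ Mp^𝓢(ℝ^{m×o})`
  of `placeSp κ⁻¹`: the section **`placeLeviSection x A := MpS.leviAlong x (GL.placeDiag ∘ A) : G →* Mp^𝓢`**
  lies over `g ↦ placePhase (v ↦ κ_v⁻¹ · m(A g v) · κ_v)` (`coe_proj_placeLeviSection`), exists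
  (`exists_placeLeviSection_lift`, `MpS.proj_surjective`) and is strongly continuous when each `g ↦ A g v` is
  (`continuous_placeLeviSection_snd_apply`).

USE: the archimedean Weil section of a unitary group over the COMPLEX places of the base field (each factor a
`GL_N(ℂ)` realified into a conjugate of the real Siegel Levi, `ArchComplexPlaceRealification.cxRealify_toSymplectic`)
— the sequel instantiates `A g v = Res (g_{w(v)})`, `κ_v = cxCayley_v`.
[Folland1989, §4.2 (4.24)]: `μ` restricted to the Levi is an honest representation; [Kudla1996, Chap. I §2]:
conjugated Levi of another polarisation; [Weil1964, Chap. I n° 12]: orthogonal sums of symplectic spaces.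

## References
* [Folland1989] G. B. Folland, *Harmonic Analysis in Phase Space*, Princeton UP (1989), §4.2 (4.24)–(4.25).
* [Kudla1996] S. S. Kudla, *Notes on the local theta correspondence* (1996), Chap. I §2 Prop. 2.3 and Remark.
* [Weil1964] A. Weil, Acta Math. 111 (1964), Chap. I n° 12 p. 160.
-/

set_option autoImplicit false

noncomputable section

open Matrix
open Literature.RepresentationTheory.HeisenbergGroup
open Literature.RepresentationTheory.HeisenbergGroup.SymplecticMatrix
open Literature.Analysis.SegalBargmann
open Literature.RepresentationTheory.KonnoKonno2007

namespace Literature.NumberTheory.Weil1964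

variable {m : Type} [Fintype m] [DecidableEq m] {o : Type} [Fintype o] [DecidableEq o]

local notation "PV" σ => (σ → ℝ) × (σ → ℝ)
local notation "SpR" σ => symplecticGroup (polar (dotPairing σ))

/-! ## §1 Block-diagonal invertible matrices over the places and their Siegel Levi -/

section GLDiag

variable (m o) in
/-- **`GL.placeDiag : (o → GL_m(ℝ)) →* GL_{m × o}(ℝ)`**, the block-diagonal matrix (`Matrix.blockDiagonal`).
[cite: Folland1989, §4.2 (4.24)] -/
def GL.placeDiag : (o → GL m ℝ) →* GL (m × o) ℝ :=
  (Units.map (Matrix.blockDiagonalRingHom m o ℝ).toMonoidHom).comp (MulEquiv.piUnits (M := fun _ : o => Matrix m m ℝ)).symm.toMonoidHom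

/-- underlying matrix. [cite: Folland1989, §4.2 (4.24)] -/
@[simp] theorem GL.coe_placeDiag (a : o → GL m ℝ) :
    ((GL.placeDiag m o a : GL (m × o) ℝ) : Matrix (m × o) (m × o) ℝ) = Matrix.blockDiagonal fun v => (a v : Matrix m m ℝ) := rfl

/-- underlying matrix of the inverse. [cite: Folland1989, §4.2 (4.24)] -/
theorem GL.coe_placeDiag_inv (a : o → GL m ℝ) :
    (((GL.placeDiag m o a)⁻¹ : GL (m × o) ℝ) : Matrix (m × o) (m × o) ℝ) =
      Matrix.blockDiagonal fun v => ((a v)⁻¹ : GL m ℝ) := by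
  rw [← map_inv]; rfl

omit [DecidableEq m] in
/-- a block-diagonal REAL matrix acts slicewise: `(blockDiagonal M · x)_{(i,v)} = (M v · x_v)_i` (real twin of the
tree's complex `blockDiagonal_mulVec_apply`). [cite: Folland1989, §4.2 (4.24)] -/
theorem blockDiagonal_mulVec_slice (M : o → Matrix m m ℝ) (x : m × o → ℝ) (i : m) (v : o) :
    (Matrix.blockDiagonal M *ᵥ x) (i, v) = (M v *ᵥ fun j => x (j, v)) i := by
  simp only [Matrix.mulVec, dotProduct, Fintype.sum_prod_type, Matrix.blockDiagonal_apply', ite_mul, zero_mul,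
    Finset.sum_ite_eq, Finset.mem_univ, if_true]

/-- **`glEquiv (GL.placeDiag a) = placeLin (v ↦ glEquiv (a v))`.** [cite: Folland1989, §4.2 (4.24)] -/
theorem glEquiv_placeDiag (a : o → GL m ℝ) : glEquiv (GL.placeDiag m o a) = placeLin fun v => glEquiv (a v) :=
  LinearEquiv.ext fun x => funext fun k => by
    obtain ⟨i, v⟩ := k
    rw [glEquiv_apply, GL.coe_placeDiag, blockDiagonal_mulVec_slice, placeLin_apply, glEquiv_apply]

/-- the contragredient of a block-diagonal matrix is block-diagonal. [cite: Folland1989, §4.2 (4.24)] -/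
theorem trInv_placeDiag (a : o → GL m ℝ) : trInv (GL.placeDiag m o a) = GL.placeDiag m o fun v => trInv (a v) := by
  apply Units.ext
  rw [coe_trInv, GL.coe_placeDiag_inv, Matrix.blockDiagonal_transpose, GL.coe_placeDiag]
  exact congrArg Matrix.blockDiagonal (funext fun v => (coe_trInv (a v)).symm)

/-- **the Siegel Levi of a block-diagonal matrix is the block-diagonal of the Siegel Levis**:
`proj (leviGL (GL.placeDiag a)) = placeSp (v ↦ proj (leviGL (a v)))`. [cite: Folland1989, §4.2 (4.24)] -/
theorem proj_leviGL_placeDiag (a : o → GL m ℝ) :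
    MpS.proj (MpS.leviGL (GL.placeDiag m o a)) = placeSp fun v => MpS.proj (MpS.leviGL (a v)) := by
  apply Subtype.ext
  apply LinearEquiv.ext
  intro pq
  refine Prod.ext (funext fun k => ?_) (funext fun k => ?_)
  · obtain ⟨i, v⟩ := k
    rw [MpS.coe_proj_leviGL_apply, GL.coe_placeDiag]
    show (Matrix.blockDiagonal (fun v => (a v : Matrix m m ℝ)) *ᵥ pq.1) (i, v) =
      (placePhase (fun v => ⇑(((MpS.proj (MpS.leviGL (a v)) : SpR m).1 : (PV m) ≃ₗ[ℝ] PV m))) pq).1 (i, v)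
    rw [blockDiagonal_mulVec_slice, placePhase_fst, MpS.coe_proj_leviGL_apply]
  · obtain ⟨i, v⟩ := k
    rw [MpS.coe_proj_leviGL_apply, GL.coe_placeDiag_inv, Matrix.blockDiagonal_transpose]
    show (Matrix.blockDiagonal (fun v => (((a v)⁻¹ : GL m ℝ) : Matrix m m ℝ)ᵀ) *ᵥ pq.2) (i, v) =
      (placePhase (fun v => ⇑(((MpS.proj (MpS.leviGL (a v)) : SpR m).1 : (PV m) ≃ₗ[ℝ] PV m))) pq).2 (i, v)
    rw [blockDiagonal_mulVec_slice, placePhase_snd, MpS.coe_proj_leviGL_apply]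

/-- `GL.placeDiag` is continuous. [cite: Folland1989, §4.2 (4.24)] -/
theorem GL.continuous_coe_placeDiag {Z : Type*} [TopologicalSpace Z] {a : Z → o → GL m ℝ}
    (ha : ∀ v, Continuous fun z => ((a z v : GL m ℝ) : Matrix m m ℝ)) :
    Continuous fun z => ((GL.placeDiag m o (a z) : GL (m × o) ℝ) : Matrix (m × o) (m × o) ℝ) := by
  simp only [GL.coe_placeDiag]
  exact Continuous.matrix_blockDiagonal (continuous_pi fun v => ha v)

/-- the inverse of `GL.placeDiag` is continuous when the slice inverses are. [cite: Folland1989, §4.2 (4.24)] -/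
theorem GL.continuous_coe_placeDiag_inv {Z : Type*} [TopologicalSpace Z] {a : Z → o → GL m ℝ}
    (ha : ∀ v, Continuous fun z => (((a z v)⁻¹ : GL m ℝ) : Matrix m m ℝ)) :
    Continuous fun z => (((GL.placeDiag m o (a z))⁻¹ : GL (m × o) ℝ) : Matrix (m × o) (m × o) ℝ) := by
  simp only [GL.coe_placeDiag_inv]
  exact Continuous.matrix_blockDiagonal (continuous_pi fun v => ha v)

end GLDiag

/-! ## §2 The place-by-place conjugated Levi section -/

section Section

variable {G : Type*} [Group G] (A : G →* (o → GL m ℝ)) (κ : o → SpR m) (x : MpS (m × o))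

variable (m o) in
/-- **`placeLeviSection x A := MpS.leviAlong x (GL.placeDiag ∘ A) : G →* Mp^𝓢(ℝ^{m×o})`**.
[cite: Kudla1996, Chap. I §2 Prop. 2.3 and Remark] -/
def placeLeviSection : G →* MpS (m × o) := MpS.leviAlong x ((GL.placeDiag m o).comp A)

/-- unfolding. [cite: Kudla1996, Chap. I §2 Prop. 2.3 and Remark] -/
theorem placeLeviSection_apply (g : G) :
    placeLeviSection m o A x g = x * MpS.leviGL (GL.placeDiag m o (A g)) * x⁻¹ := rfl

/-- **over `g ↦ placePhase (v ↦ κ_v⁻¹ · m(A g v) · κ_v)`** when `proj x = placeSp κ⁻¹`.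
[cite: Kudla1996, Chap. I §2 Prop. 2.3 and Remark] -/
theorem proj_placeLeviSection (hx : MpS.proj x = placeSp fun v => (κ v)⁻¹) (g : G) :
    MpS.proj (placeLeviSection m o A x g) = placeSp fun v => (κ v)⁻¹ * MpS.proj (MpS.leviGL (A g v)) * κ v := by
  have h : (fun v => (κ v)⁻¹ * MpS.proj (MpS.leviGL (A g v)) * κ v) =
      (fun v => (κ v)⁻¹) * (fun v => MpS.proj (MpS.leviGL (A g v))) * (fun v => (κ v)⁻¹)⁻¹ := by
    funext v
    rw [Pi.mul_apply, Pi.mul_apply, Pi.inv_apply, inv_inv]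
  rw [placeLeviSection, MpS.proj_leviAlong, hx, MonoidHom.comp_apply, proj_leviGL_placeDiag, ← map_mul, ← map_inv,
    ← map_mul, h]

/-- the same on phase space: `⇑(proj (placeLeviSection x A g)) = placePhase (v ↦ ⇑(κ_v⁻¹ · m(A g v) · κ_v))`.
[cite: Kudla1996, Chap. I §2 Prop. 2.3 and Remark] -/
theorem coe_proj_placeLeviSection (hx : MpS.proj x = placeSp fun v => (κ v)⁻¹) (g : G) :
    (⇑(((MpS.proj (placeLeviSection m o A x g) : SpR (m × o)).1 : (PV (m × o)) ≃ₗ[ℝ] PV (m × o))) : PhaseMap (m × o)) =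
      placePhase fun v => ⇑((((κ v)⁻¹ * MpS.proj (MpS.leviGL (A g v)) * κ v : SpR m).1 : (PV m) ≃ₗ[ℝ] PV m)) := by
  rw [proj_placeLeviSection A κ x hx, coe_placeSp]

/-- **a lift `x` of `placeSp κ⁻¹` exists** (Folland's `π : Mp^𝓢 → Sp` is onto). [cite: Folland1989, §4.2 Prop. (4.39)] -/
theorem exists_placeLeviSection_lift : ∃ x : MpS (m × o), MpS.proj x = placeSp fun v => (κ v)⁻¹ :=
  MpS.proj_surjective _

/-- **independence of the lift**: two lifts of `placeSp κ⁻¹` give the same section. [cite: Kudla1996, Chap. I §2 Remark] -/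
theorem placeLeviSection_eq_of_proj_eq {x y : MpS (m × o)} (hxy : MpS.proj x = MpS.proj y) :
    placeLeviSection m o A y = placeLeviSection m o A x :=
  MpS.leviAlong_eq_of_proj_eq hxy _

/-- **strong continuity**: every orbit map `g ↦ S_{placeLeviSection x A g} f` is continuous when each
`g ↦ (A g v)⁻¹` is entrywise continuous. [cite: Folland1989, §4.2 (4.24); Weil1964, Chap. III n° 39 p. 189] -/
theorem continuous_placeLeviSection_snd_apply [TopologicalSpace G]
    (hA : ∀ v, Continuous fun g => (((A g v)⁻¹ : GL m ℝ) : Matrix m m ℝ)) (f : SchwartzMap (m × o → ℝ) ℂ) :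
    Continuous fun g => (placeLeviSection m o A x g).1.2 f :=
  MpS.continuous_leviAlong_snd_apply x ((GL.placeDiag m o).comp A) (GL.continuous_coe_placeDiag_inv hA) f

/-- continuity of the `π`-orbit maps. [cite: Weil1964, Chap. III n° 39 p. 189] -/
theorem continuous_proj_placeLeviSection_apply [TopologicalSpace G]
    (hA : ∀ v, Continuous fun g => ((A g v : GL m ℝ) : Matrix m m ℝ))
    (hA' : ∀ v, Continuous fun g => (((A g v)⁻¹ : GL m ℝ) : Matrix m m ℝ)) (w : PV (m × o)) :
    Continuous fun g => ((MpS.proj (placeLeviSection m o A x g) : SpR (m × o)) :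
      (PV (m × o)) ≃ₗ[ℝ] PV (m × o)) w :=
  MpS.continuous_proj_leviAlong_apply x ((GL.placeDiag m o).comp A) (GL.continuous_coe_placeDiag hA)
    (GL.continuous_coe_placeDiag_inv hA') w

end Section

end Literature.NumberTheory.Weil1964

end
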